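import Mathlib.AlgebraicTopology.FundamentalGroupoid.SimplyConnected
import Literature.Geometry.Kaehler.DeformationEquivalence
import Literature.Geometry.Hyperkaehler.IrreducibleSymplectic
import Literature.AlgebraicGeometry.HodgeTheory.HodgeConjecture
import Literature.AlgebraicGeometry.HodgeTheory.GysinFormalism
import Literature.AlgebraicGeometry.Motives.AlgPointsProperProofs
import Literature.AlgebraicGeometry.Motives.VarietiesProperProofs
import HarnessLib

/-!
# Deformation equivalence of smooth complex varieties; manifolds of O'Grady-six (OG6) type

Layer `Literature/AlgebraicGeometry/Hyperkaehler`. Definition item `defn-IsOfOGradySixType` (route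
HodgeConjecture/OG6CharacterSectors, item stmt-HodgeConjecture-9353): "`IsOfOGradySixType X` —
`X(ℂ)` (equivalently a Hodge model of `X`) is deformation equivalent, through smooth proper
holomorphic families over connected bases, to O'Grady's six-dimensional irreducible holomorphic
symplectic manifold: the crepant resolution `K̃_v(A,H)` of the Albanese fibre `K_v(A,H)` of the
moduli space `M_v(A,H)` of `H`-semistable sheaves with Mukai vector `v = 2v₀` (`v₀` primitive,
`v₀² = 2`) on an abelian surface `A`"; with the sub-layer "deformation equivalence, IHS manifold,
`Aut₀(X) := ker(Aut X → GL(H²))`".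

## Sources (read; PDF pages of the materialised texts)

* K. O'Grady, *A new six-dimensional irreducible symplectic variety*, J. Algebraic Geom. 12 (2003)
  435–505 (arXiv:math/0010187), §1 Thm. (1.4) (p. 1): for `J` the Jacobian of a genus-2 curve with
  (1.3), `v = 2 − 2η_J` (rank 2, `c₁ = 0`, `c₂ = 2`), `ℳ̃ := ã_v⁻¹(0, 0̂) ⊂ ℳ̃_v` the Albanese fibre
  of O'Grady's symplectic desingularisation of `ℳ_v(J, Θ)`: "`ℳ̃` is a `6`-dimensional irreducible
  symplectic variety, i.e. one-connected and with `H^{2,0}(ℳ̃)` spanned by the symplectic form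
  `ω̃`. Furthermore `b₂(ℳ̃) = 8`."
* A. Perego, A. Rapagnetta, *Deformation of the O'Grady moduli spaces*, J. reine angew. Math. 678
  (2013) (arXiv:1008.0190), Thm. 1.3 (O'Grady: `K̃₆ := K̃_{(2,0,−2)}(S, H)`, `S` abelian, `H`
  `v`-generic, is irreducible symplectic of dimension `6`, `b₂ = 8`), Def. 1.5 (OLS-triple), Thm. 1.6:
  "If `S` is abelian, then `K̃_v(S,H)` is an irreducible symplectic variety which is deformation
  equivalent to `K̃₆`" — the deformation class does not depend on `(S, v, H)`: this class is "OG6".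
* G. Mongardi, A. Rapagnetta, G. Saccà, *The Hodge diamond of O'Grady's six-dimensional example*,
  Compos. Math. 154 (2018) (arXiv:1603.06731), §1 and Thm. 1.1 (p. 5): "Let `K̃` be an irreducible
  holomorphic symplectic of type OG6. The odd Betti numbers of `K̃` are zero, and its non-zero Hodge
  numbers are" `h^{0,0}=1; h^{2,0}=h^{0,2}=1, h^{1,1}=6; h^{4,0}=h^{0,4}=1, h^{3,1}=h^{1,3}=12,
  h^{2,2}=173; h^{6,0}=h^{0,6}=1, h^{5,1}=h^{1,5}=6, h^{4,2}=h^{2,4}=173, h^{3,3}=1144` and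
  symmetrically (so `b₀..b₁₂ = 1,0,8,0,199,0,1504,0,199,0,8,0,1`, `χ_top = 1920`).
* G. Mongardi, M. Wandel, *Automorphisms of O'Grady's manifolds acting trivially on cohomology*,
  Algebraic Geometry 4 (2017) (arXiv:1411.0759), Thm. 4.2 (p. 10): "Let `X` be a manifold of
  OG6-type. Then the kernel of the cohomological representation `ν : Aut(X) → O(H²(X,ℤ))` is
  isomorphic to `G₀ := ⟨A[2], A^*[2]⟩ ≅ (ℤ/2ℤ)^{×8}`"; Prop. 1.3 (Huybrechts: `ker ν` finite),
  Thm. 1.4 (Hassett–Tschinkel: `ker ν` is a deformation invariant).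
* D. Huybrechts, Invent. Math. 135 (1999), Def. 1.1 (irreducible symplectic) and §4 ("deformation
  equivalent"); K. Kodaira, Def. 2.8–2.9; J.-P. Serre, GAGA §2 (analytification).

## What can and cannot be named (design)

O'Grady's `K̃_v(A,H)` is a symplectic resolution of a subvariety of a MODULI SPACE OF GIESEKER
`H`-SEMISTABLE SHEAVES (a projective scheme corepresenting the functor of flat families of
semistable sheaves with fixed Mukai vector). Neither Mathlib nor the tree has any of: flat families
of coherent sheaves, Hilbert polynomials / Euler characteristics of coherent sheaves, Gieseker
(semi)stability, S-equivalence, corepresentability of moduli functors — nor Hilbert schemes of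
points (through which the other descriptions of this deformation class factor: Mongardi–Rapagnetta–
Saccà realise `K̃_v` from a SPECIFIC K3⁽³⁾-type manifold `Y_v`, again a moduli space). No intrinsic
characterisation of the OG6 deformation class is known (the classification of hyperkähler
sixfolds is open; contrast K3 surfaces, `Surfaces/K3Surface`). Consequently the CLASS
"deformation equivalent to `K̃_v(A,H)`" has no closed Lean spelling today, and this file does NOT
pretend otherwise. What it provides:

1. `AreDeformationEquivalent n X Y` for `ℂ`-schemes: some analytifications `X^an`, `Y^an`
   (`Literature.NumberTheory.Transcendental.IsAnalytification`, holomorphic atlases bundled as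
   `Geometry.Kaehler.ComplexManifold`) are deformation equivalent compact complex manifolds
   (`Geometry.Kaehler.IsDeformationEquivalent`: chains of proper holomorphic submersions over
   connected bases, Kodaira Def. 2.8–2.9). REAL definition; junk analysis below.
2. `IsProjectiveIrreducibleSymplectic n X`: `X` smooth projective of dimension `n`, `X(ℂ)` simply
   connected, and on some Hodge model the holomorphic `2`-forms are spanned by an everywhere
   non-degenerate one (Huybrechts Def. 1.1 for `X^an`; "compact Kähler" is automatic for `X`
   projective, whence not a clause — the manifold notion with the Kähler clause is
   `Geometry.Hyperkaehler.IsIrreducibleSymplectic`).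
3. `autZero X ≤ Aut X`: the automorphisms of the `ℂ`-scheme `X` acting trivially on `H²(X(ℂ); ℂ)`
   (Mongardi–Wandel's `ker ν`, with `ℂ`- for `ℤ`-coefficients: the same subgroup whenever `H²(X, ℤ)`
   is torsion-free, e.g. `X(ℂ)` simply connected; `Aut X = Aut X^an` by GAGA for `X` proper).
4. The published numerical data of the class: `ogradySixBetti`, `ogradySixHodge` (MRS Thm. 1.1),
   with the arithmetic checks `sum_ogradySixHodge_eq` and `ogradySix_eulerChar` (`χ_top = 1920`).
5. `OGradySixReference` — a HYPOTHESIS STRUCTURE (tree pattern: `HodgeTheory.GysinFormalism`,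
   `Motives.VHSData`): a smooth projective `ℂ`-variety `K` INTENDED to be O'Grady's `K̃_v(A,H)`,
   carrying as fields the published, deformation-invariant properties of `K̃_v` that the tree can
   state and that consumers use — projective irreducible symplectic sixfold (O'Grady (1.4)), Betti
   and Hodge numbers (MRS Thm. 1.1), `Aut₀ ≅ (ℤ/2)^8` (Mongardi–Wandel Thm. 4.2). The identification
   `K = K̃_v(A,H)` is NOT a field (it cannot be written); it is the documented intended instance.
6. `IsOfOGradySixType K X := AreDeformationEquivalent 6 K.variety X` — **`X` is of OG6 type
   relative to the reference `K`**. FAITHFUL READING: for `K.variety = K̃_v(A,H)` (any OLS-triple,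
   Perego–Rapagnetta Thm. 1.6) this is exactly "`X` is a (projective) manifold of OG6 type".

How consumers use (6) honestly: quantify `∀ K : OGradySixReference` over the WHOLE statement
(e.g. `∀ K X, IsOfOGradySixType K X → … → HodgeConjectureFor 6 X`). Since the intended reference
exists (O'Grady 2003 + the cited theorems give every field for `K̃_v`), such a statement
SPECIALISES to the honest one; it is never weaker. Junk analysis: a `K` satisfying the fields but
not deformation equivalent to `K̃_v` — none is known, and exhibiting one would be a new deformation
type of hyperkähler sixfolds with the OG6 invariants — would make `IsOfOGradySixType K` a different
class with the same recorded invariants; statements proved for all `K` stay true for the honest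
`K`. The opposite quantifier choices are wrong: `∃ K` would be WIDER than OG6 type if such junk
exists, `∀ K` inside the definition would be empty if two inequivalent references exist.

Junk analysis for (1): analytifications of a smooth `X` are unique up to biholomorphism over
`X(ℂ)` (`IsAnalytification.unique`, GAGA) and `IsDeformationEquivalent` is invariant under
biholomorphism (`IsDeformationEquivalent.of_diffeomorph`), so `∃` over analytifications agrees with
`∀` given existence (`exists_isAnalytification`); if `X` is not smooth of dimension `n` no
analytification exists and the predicate is `False` (safe side: nothing is wrongly declared
deformation equivalent). Only compact manifolds can be deformation equivalent to a proper `X`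
(`IsDeformationOf.compactSpace_left`).

## API (all proved)

`AreDeformationEquivalent.symm`, `.of_hodgeModel` (Hodge models are analytifications),
`areDeformationEquivalent_self` (a smooth PROPER `X` with a Hodge model is deformation equivalent
to itself — non-vacuity, using the tree's theorem `compactSpace_algPoints_of_isProper_holds`, the
`T2Space` field of `HodgeModel` and Mathlib's `ChartedSpace.secondCountable_of_sigmaCompact`),
`compactSpace_hodgeModel`, `mem_autZero_iff`, `OGradySixReference.isProper`, `.card_autZero`
(`|Aut₀| = 256`), `.finrank_complexBetti_odd`, `.hodgeConjectureFor_iff` (HC for `K` is its cycle part),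
`OGradySixReference.isOfOGradySixType_self` (**the reference is of OG6 type relative to itself**),
`.nonempty_hodgeModel`, `.isProjectiveIrreducibleSymplectic`, `.finrank_complexBetti_two` (`b₂ = 8`),
`IsOfOGradySixType.areDeformationEquivalent/symm-type lemmas`, and the table identities by `decide`.

## Not here (each a theory or a cite item)

The moduli spaces `M_v(A,H)`, `K_v`, `K̃_v` themselves (see above); the Beauville–Bogomolov form and
the OG6 lattice `U³ ⊕ ⟨−2⟩²` (Rapagnetta 2008); the LLV algebra; Ehresmann/Hassett–Tschinkel
deformation invariance of Betti numbers and of `Aut₀` (MW Thm. 1.4) — the facts that turn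
`IsOfOGradySixType K X` plus the fields of `K` into the route's "OG6 frame" for `X`; the algebraic
variant of deformation equivalence through `Motives.IsSmoothProjectiveFamily` (for projective
hyperkähler manifolds expected, not proved here, to give the same classes).
-/

noncomputable section

open scoped Manifold ContDiff Topology
open CategoryTheory
open Literature.Geometry.Kaehler
open Literature.NumberTheory.Transcendental (IsAnalytification)

namespace Literature.AlgebraicGeometry.Hyperkaehler

/-! ### Hodge models as bundled complex manifolds -/

/-- The complex manifold `X^an` underlying a Hodge model of `X`, bundled. Deliberate dot-notation
extension of `HodgeTheory.HodgeModel` (declared with its absolute name). [cite: SerreGAGA1956, §2] -/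
abbrev _root_.Literature.AlgebraicGeometry.HodgeTheory.HodgeModel.toComplexManifold {n : ℕ}
    {X : Motives.SchemeOver ℂ} (A : HodgeTheory.HodgeModel n X) : ComplexManifold.{0} :=
  ComplexManifold.of A.model A.carrier

/-! ### Deformation equivalence of smooth complex varieties -/

/-- **`X` and `Y` are deformation equivalent** (smooth `ℂ`-schemes of dimension `n`): there are
analytifications `φ : M → X(ℂ)`, `ψ : N → Y(ℂ)` (complex manifolds with holomorphic atlases which
ARE `X^an`, `Y^an`: `IsAnalytification`, Serre GAGA §2) such that the complex manifolds `M`, `N`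
(then necessarily compact) are deformation equivalent — connected by proper holomorphic submersions over
connected bases (`Geometry.Kaehler.IsDeformationEquivalent`, Kodaira Def. 2.8–2.9). `∃` over
analytifications = `∀` given existence (GAGA uniqueness + biholomorphism invariance; module
docstring). [cite: Kodaira2005, §2.3 Def. 2.9] [cite: SerreGAGA1956, §2] -/
def AreDeformationEquivalent (n : ℕ) (X Y : Motives.SchemeOver ℂ) : Prop :=
  ∃ (M N : ComplexManifold.{0}) (φ : M → Motives.ComplexPoints X) (ψ : N → Motives.ComplexPoints Y),
    IsAnalytification M.model X n φ ∧ IsAnalytification N.model Y n ψ ∧ IsDeformationEquivalent M N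

namespace AreDeformationEquivalent

variable {n : ℕ} {X Y : Motives.SchemeOver ℂ}

/-- Unfolding lemma. [cite: Kodaira2005, §2.3 Def. 2.9] -/
theorem iff : AreDeformationEquivalent n X Y ↔
    ∃ (M N : ComplexManifold.{0}) (φ : M → Motives.ComplexPoints X)
      (ψ : N → Motives.ComplexPoints Y),
      IsAnalytification M.model X n φ ∧ IsAnalytification N.model Y n ψ ∧
        IsDeformationEquivalent M N :=
  Iff.rfl

/-- Symmetry. [folklore] -/
theorem symm (h : AreDeformationEquivalent n X Y) : AreDeformationEquivalent n Y X := by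
  obtain ⟨M, N, φ, ψ, hφ, hψ, hMN⟩ := h
  exact ⟨N, M, ψ, φ, hψ, hφ, hMN.symm⟩

/-- Hodge models are analytifications: deformation equivalence of the complex manifolds underlying
Hodge models of `X` and `Y` gives `AreDeformationEquivalent n X Y`. [cite: SerreGAGA1956, §2] -/
theorem of_hodgeModel (A : HodgeTheory.HodgeModel n X) (B : HodgeTheory.HodgeModel n Y)
    (h : IsDeformationEquivalent A.toComplexManifold B.toComplexManifold) :
    AreDeformationEquivalent n X Y :=
  ⟨A.toComplexManifold, B.toComplexManifold, A.toComplexPoints, B.toComplexPoints,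
    A.isAnalytification, B.isAnalytification, h⟩

end AreDeformationEquivalent

/-- The complex manifold underlying a Hodge model of a PROPER `ℂ`-scheme is compact (`X(ℂ)` is
compact, the tree's theorem `compactSpace_algPoints_of_isProper_holds`, transported along the
homeomorphism `X^an ≃ X(ℂ)`). [cite: SerreGAGA1956, §2 Prop. 6] -/
theorem compactSpace_hodgeModel {n : ℕ} {X : Motives.SchemeOver ℂ} [AlgebraicGeometry.IsProper X.hom]
    (A : HodgeTheory.HodgeModel n X) : CompactSpace A.carrier := by
  haveI : CompactSpace (Motives.ComplexPoints X) :=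
    Motives.compactSpace_algPoints_of_isProper_holds X ℂ
  exact A.isAnalytification.homeomorph.symm.compactSpace

/-- **Non-vacuity.** A proper smooth `ℂ`-scheme with a Hodge model is deformation equivalent to
itself (the constant family over a point, `Geometry.Kaehler.isDeformationOf_self`; `X^an` is
compact, Hausdorff and second countable). [cite: Kodaira2005, §2.3 (trivial family)] -/
theorem areDeformationEquivalent_self {n : ℕ} {X : Motives.SchemeOver ℂ}
    [AlgebraicGeometry.IsProper X.hom] (A : HodgeTheory.HodgeModel n X) :
    AreDeformationEquivalent n X X := by
  haveI : CompactSpace A.carrier := compactSpace_hodgeModel A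
  haveI : SecondCountableTopology A.carrier :=
    ChartedSpace.secondCountable_of_sigmaCompact A.model A.carrier
  exact AreDeformationEquivalent.of_hodgeModel A A
    (isDeformationOf_self A.toComplexManifold).isDeformationEquivalent

/-! ### Projective irreducible symplectic varieties -/

/-- **`X` is a projective irreducible (holomorphic) symplectic variety of dimension `n`**
(Huybrechts 1999 Def. 1.1 for `X^an`; O'Grady 2003 §1: "one-connected and with `H^{2,0}` spanned by
the symplectic form"): `X` is smooth projective of dimension `n`, `X(ℂ)` is simply connected, and
on some Hodge model `X^an` there is a `2`-form `σ`, holomorphic in charts and non-degenerate at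
every point, of which every holomorphic `2`-form is a complex multiple. "Compact Kähler" (clause
(i) of Huybrechts' definition) holds for `X^an`, `X` being projective, and is therefore not a
clause; the manifold notion with it is `Geometry.Hyperkaehler.IsIrreducibleSymplectic`. `∃` over
Hodge models as in `Surfaces.IsK3Surface` (all models are biholomorphic over `X(ℂ)`).
[cite: Huybrechts1999, §1 Def. 1.1] [cite: Ogrady2003, §1 Thm. (1.4)] -/
def IsProjectiveIrreducibleSymplectic (n : ℕ) (X : Motives.SchemeOver ℂ) : Prop :=
  Motives.IsSmoothProjective n X ∧ SimplyConnectedSpace (Motives.ComplexPoints X) ∧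
    ∃ (A : HodgeTheory.HodgeModel n X) (σ : MForm 𝓘(ℝ, A.model) A.carrier ℂ 2),
      IsHolomorphicInCharts σ ∧ (∀ x, σ.IsNondegenerateAt x) ∧
        ∀ τ : MForm 𝓘(ℝ, A.model) A.carrier ℂ 2, IsHolomorphicInCharts τ → ∃ c : ℂ, τ = c • σ

/-- Unfolding lemma. [cite: Huybrechts1999, §1 Def. 1.1] -/
theorem isProjectiveIrreducibleSymplectic_iff {n : ℕ} {X : Motives.SchemeOver ℂ} :
    IsProjectiveIrreducibleSymplectic n X ↔
      Motives.IsSmoothProjective n X ∧ SimplyConnectedSpace (Motives.ComplexPoints X) ∧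
        ∃ (A : HodgeTheory.HodgeModel n X) (σ : MForm 𝓘(ℝ, A.model) A.carrier ℂ 2),
          IsHolomorphicInCharts σ ∧ (∀ x, σ.IsNondegenerateAt x) ∧
            ∀ τ : MForm 𝓘(ℝ, A.model) A.carrier ℂ 2, IsHolomorphicInCharts τ →
              ∃ c : ℂ, τ = c • σ :=
  Iff.rfl

/-! ### Automorphisms acting trivially on `H²` -/

/-- **`Aut₀(X)`**: the subgroup of automorphisms of the `ℂ`-scheme `X` (Mathlib `Aut X` in
`Over (Spec ℂ)`; `= Aut(X^an)` by GAGA for `X` proper) acting trivially on `H²(X(ℂ); ℂ)` — the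
kernel of the cohomological representation `ν : Aut(X) → GL(H²)`. Mongardi–Wandel use
`O(H²(X, ℤ))`; with `ℂ`-coefficients one gets the same kernel whenever `H²(X, ℤ)` is torsion-free
(e.g. `X(ℂ)` simply connected), and in general the automorphisms acting trivially on `H²(X, ℤ)`
modulo torsion. [cite: MongardiWandel2017, §1 (the cohomological representation ν) and Thm. 4.2] -/
def autZero (X : Motives.SchemeOver ℂ) : Subgroup (Aut X) where
  carrier := {f | HodgeTheory.complexBetti.map f.hom 2 = 𝟙 _}
  one_mem' := HodgeTheory.complexBetti.map_id (X := X) 2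
  mul_mem' {f g} hf hg := by
    change HodgeTheory.complexBetti.map (g.hom ≫ f.hom) 2 = 𝟙 _
    rw [HodgeTheory.complexBetti.map_comp, hf, hg, Category.id_comp]
  inv_mem' {f} hf := by
    change HodgeTheory.complexBetti.map f.inv 2 = 𝟙 _
    have h := HodgeTheory.complexBetti.map_comp f.inv f.hom 2
    rw [f.inv_hom_id, HodgeTheory.complexBetti.map_id] at h
    rw [hf, Category.id_comp] at h
    exact h.symm

/-- Membership in `Aut₀(X)`: `f^* = id` on `H²(X(ℂ); ℂ)`. [cite: MongardiWandel2017, Thm. 4.2] -/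
theorem mem_autZero_iff {X : Motives.SchemeOver ℂ} (f : Aut X) :
    f ∈ autZero X ↔ HodgeTheory.complexBetti.map f.hom 2 = 𝟙 _ :=
  Iff.rfl

/-! ### The numerical invariants of OG6 (Mongardi–Rapagnetta–Saccà) -/

/-- The Betti numbers `b₀, …, b₁₂ = 1, 0, 8, 0, 199, 0, 1504, 0, 199, 0, 8, 0, 1` of a manifold of
OG6 type (`b₂ = 8`: O'Grady (1.4); all: MRS Thm. 1.1, odd ones vanish), `0` above degree `12`.
[cite: MongardiRapagnettaSacca2018, Thm. 1.1] [cite: Ogrady2003, §1 Thm. (1.4)] -/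
def ogradySixBetti : ℕ → ℕ
  | 0 => 1
  | 2 => 8
  | 4 => 199
  | 6 => 1504
  | 8 => 199
  | 10 => 8
  | 12 => 1
  | _ => 0

/-- The Hodge numbers `h^{p,q}` of a manifold of OG6 type (MRS Thm. 1.1, the printed diamond:
`h^{0,0}=1; h^{2,0}=h^{0,2}=1, h^{1,1}=6; h^{4,0}=h^{0,4}=1, h^{3,1}=h^{1,3}=12, h^{2,2}=173;
h^{6,0}=h^{0,6}=1, h^{5,1}=h^{1,5}=6, h^{4,2}=h^{2,4}=173, h^{3,3}=1144`, Serre-symmetrically in the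
upper half; all others `0`). [cite: MongardiRapagnettaSacca2018, Thm. 1.1] -/
def ogradySixHodge : ℕ → ℕ → ℕ
  | 0, 0 => 1
  | 2, 0 => 1 | 1, 1 => 6 | 0, 2 => 1
  | 4, 0 => 1 | 3, 1 => 12 | 2, 2 => 173 | 1, 3 => 12 | 0, 4 => 1
  | 6, 0 => 1 | 5, 1 => 6 | 4, 2 => 173 | 3, 3 => 1144 | 2, 4 => 173 | 1, 5 => 6 | 0, 6 => 1
  | 6, 2 => 1 | 5, 3 => 12 | 4, 4 => 173 | 3, 5 => 12 | 2, 6 => 1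
  | 6, 4 => 1 | 5, 5 => 6 | 4, 6 => 1
  | 6, 6 => 1
  | _, _ => 0

/-- Consistency of the two tables: `b_k = Σ_{p+q=k} h^{p,q}` for `k ≤ 12` (e.g.
`b₄ = 1+12+173+12+1 = 199`, `b₆ = 1+6+173+1144+173+6+1 = 1504`). [cite: MongardiRapagnettaSacca2018, Thm. 1.1] -/
theorem sum_ogradySixHodge_eq (k : Fin 13) :
    ∑ pq ∈ Finset.antidiagonal (k : ℕ), ogradySixHodge pq.1 pq.2 = ogradySixBetti k := by
  fin_cases k <;> decide

/-- The topological Euler characteristic of OG6 is `1 + 8 + 199 + 1504 + 199 + 8 + 1 = 1920`.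
[cite: MongardiRapagnettaSacca2018, §1 (χ_top known) and Thm. 1.1] -/
theorem ogradySix_eulerChar : ∑ k ∈ Finset.range 13, (-1 : ℤ) ^ k * ogradySixBetti k = 1920 := by
  decide

/-! ### The OG6 reference datum and manifolds of OG6 type -/

/-- **Reference datum for the OG6 deformation class** (hypothesis structure). A smooth projective
complex variety `variety`, INTENDED INSTANCE: O'Grady's `K̃_v(A,H)` — the symplectic resolution of
the Albanese fibre `K_v(A,H)` of the moduli space of `H`-semistable sheaves with Mukai vector
`v = 2v₀`, `v₀² = 2`, on an abelian surface `A` (O'Grady 2003 for `v = (2,0,−2)`; any OLS-triple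
gives the same deformation class, Perego–Rapagnetta Thm. 1.6) — which the tree cannot yet name
(no moduli spaces of semistable sheaves; module docstring). The fields are the published,
deformation-invariant properties of `K̃_v(A,H)` on the tree's carriers: a projective irreducible
symplectic sixfold (O'Grady Thm. (1.4)), the Betti and Hodge numbers of MRS Thm. 1.1 (with
`b₂ = 8`, O'Grady), and `Aut₀ ≅ (ℤ/2ℤ)^8` (Mongardi–Wandel Thm. 4.2). Statements against it are to be
quantified `∀ K : OGradySixReference` (they then specialise to the honest ones at `K̃_v`).
[cite: Ogrady2003, §1 Thm. (1.4)] [cite: PeregoRapagnetta2013, Thm. 1.3 and Thm. 1.6]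
[cite: MongardiRapagnettaSacca2018, Thm. 1.1] [cite: MongardiWandel2017, Thm. 4.2] -/
structure OGradySixReference : Type 1 where
  /-- The reference variety `K` (intended: `K̃_v(A,H)`). [cite: Ogrady2003, §1 Thm. (1.4)] -/
  variety : Motives.SchemeOver ℂ
  /-- `K` is smooth projective of dimension `6` (a projective symplectic resolution).
  [cite: PeregoRapagnetta2013, Thm. 1.3] -/
  isSmoothProjective : Motives.IsSmoothProjective 6 variety
  /-- `K(ℂ)` is simply connected ("one-connected"). [cite: Ogrady2003, §1 Thm. (1.4)] -/
  simplyConnectedSpace : SimplyConnectedSpace (Motives.ComplexPoints variety)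
  /-- `H⁰(K^an, Ω²)` is spanned by an everywhere non-degenerate holomorphic `2`-form, on some Hodge
  model. [cite: Ogrady2003, §1 Thm. (1.4)] -/
  exists_symplecticForm : ∃ (A : HodgeTheory.HodgeModel 6 variety)
    (σ : MForm 𝓘(ℝ, A.model) A.carrier ℂ 2), IsHolomorphicInCharts σ ∧
      (∀ x, σ.IsNondegenerateAt x) ∧
        ∀ τ : MForm 𝓘(ℝ, A.model) A.carrier ℂ 2, IsHolomorphicInCharts τ → ∃ c : ℂ, τ = c • σ
  /-- The Betti numbers of `K(ℂ)` are `1,0,8,0,199,0,1504,0,199,0,8,0,1,0,…`.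
  [cite: MongardiRapagnettaSacca2018, Thm. 1.1] -/
  finrank_complexBetti : ∀ k : ℕ,
    Module.finrank ℂ (HodgeTheory.complexBetti variety k) = ogradySixBetti k
  /-- `H^k(K(ℂ); ℂ)` is finite-dimensional for every `k` (so that `finrank` is not junk).
  [cite: MongardiRapagnettaSacca2018, Thm. 1.1] -/
  finite_complexBetti : ∀ k : ℕ, Module.Finite ℂ (HodgeTheory.complexBetti variety k)
  /-- The Hodge numbers: on some Hodge model, `dim H^{p,q} = ogradySixHodge p q`.
  [cite: MongardiRapagnettaSacca2018, Thm. 1.1] -/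
  finrank_hodgePQ : ∃ A : HodgeTheory.HodgeModel 6 variety, ∀ k p q : ℕ, p + q = k →
    Module.finrank ℂ (A.hodgePQ k p q) = ogradySixHodge p q
  /-- `Aut₀(K) ≅ (ℤ/2ℤ)^8`. [cite: MongardiWandel2017, Thm. 4.2] -/
  nonempty_autZero_mulEquiv : Nonempty (autZero variety ≃* Multiplicative (Fin 8 → ZMod 2))

/-- **`X` is of O'Grady-six (OG6) type, relative to the reference `K`**: `X(ℂ)` is deformation
equivalent — through chains of proper holomorphic submersions over connected bases — to `K(ℂ)`
(`AreDeformationEquivalent 6 K.variety X`). For `K.variety = K̃_v(A,H)` (the documented intended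
instance of `OGradySixReference`) this is literally "`X` is a (projective) manifold of OG6 type"
(Mongardi–Wandel: "manifolds which are deformation equivalent to O'Grady's sporadic examples";
Perego–Rapagnetta Thm. 1.6: independent of `(A, v, H)`). Consumers quantify `∀ K`; see the module
docstring for the junk analysis. [cite: PeregoRapagnetta2013, Thm. 1.6]
[cite: MongardiWandel2017, §1] [cite: Kodaira2005, §2.3 Def. 2.9] -/
def IsOfOGradySixType (K : OGradySixReference) (X : Motives.SchemeOver ℂ) : Prop :=
  AreDeformationEquivalent 6 K.variety X

/-- Unfolding lemma. [cite: PeregoRapagnetta2013, Thm. 1.6] -/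
theorem isOfOGradySixType_iff (K : OGradySixReference) (X : Motives.SchemeOver ℂ) :
    IsOfOGradySixType K X ↔ AreDeformationEquivalent 6 K.variety X :=
  Iff.rfl

namespace OGradySixReference

variable (K : OGradySixReference)

/-- The reference variety is proper over `ℂ` (it is projective). [cite: PeregoRapagnetta2013, Thm. 1.3] -/
theorem isProper : AlgebraicGeometry.IsProper K.variety.hom :=
  K.isSmoothProjective.isProjectiveOver.isProper

/-- The reference variety has a Hodge model (so `HodgeConjectureFor 6 K.variety` has its
anti-vacuity conjunct). [cite: Ogrady2003, §1 Thm. (1.4)] -/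
theorem nonempty_hodgeModel : Nonempty (HodgeTheory.HodgeModel 6 K.variety) := by
  obtain ⟨A, -⟩ := K.exists_symplecticForm
  exact ⟨A⟩

/-- The reference variety is a projective irreducible symplectic sixfold.
[cite: Ogrady2003, §1 Thm. (1.4)] -/
theorem isProjectiveIrreducibleSymplectic : IsProjectiveIrreducibleSymplectic 6 K.variety :=
  ⟨K.isSmoothProjective, K.simplyConnectedSpace, K.exists_symplecticForm⟩

/-- For the reference variety the Hodge conjecture is exactly its cycle part (the Hodge-model
conjunct of `HodgeConjectureFor` holds). [cite: Deligne2000, §1] -/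
theorem hodgeConjectureFor_iff :
    HodgeTheory.HodgeConjectureFor 6 K.variety ↔
      ∀ (p : ℕ) (c : HodgeTheory.complexBetti K.variety (2 * p)),
        HodgeTheory.IsRationalClass c → HodgeTheory.IsOfHodgeType 6 K.variety (2 * p) p p c →
          c ∈ HodgeTheory.algebraicClasses K.variety p := by
  obtain ⟨A⟩ := K.nonempty_hodgeModel
  exact HodgeTheory.hodgeConjectureFor_iff_of_hodgeModel A

/-- `b₂(K) = 8` (O'Grady). [cite: Ogrady2003, §1 Thm. (1.4)] -/
theorem finrank_complexBetti_two :
    Module.finrank ℂ (HodgeTheory.complexBetti K.variety 2) = 8 :=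
  K.finrank_complexBetti 2

/-- `b₄(K) = 199`, `b₆(K) = 1504` (MRS). [cite: MongardiRapagnettaSacca2018, Thm. 1.1] -/
theorem finrank_complexBetti_four_six :
    Module.finrank ℂ (HodgeTheory.complexBetti K.variety 4) = 199 ∧
      Module.finrank ℂ (HodgeTheory.complexBetti K.variety 6) = 1504 :=
  ⟨K.finrank_complexBetti 4, K.finrank_complexBetti 6⟩

/-- The odd Betti numbers of `K` vanish (MRS). [cite: MongardiRapagnettaSacca2018, Thm. 1.1] -/
theorem finrank_complexBetti_odd (j : ℕ) :
    Module.finrank ℂ (HodgeTheory.complexBetti K.variety (2 * j + 1)) = 0 := by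
  rw [K.finrank_complexBetti]
  have key : ∀ m : ℕ, ogradySixBetti m ≠ 0 → m % 2 = 0 := by
    intro m hm
    match m, hm with
    | 0, _ => rfl | 2, _ => rfl | 4, _ => rfl | 6, _ => rfl | 8, _ => rfl | 10, _ => rfl
    | 12, _ => rfl
    | 1, h => exact absurd rfl h | 3, h => exact absurd rfl h | 5, h => exact absurd rfl h
    | 7, h => exact absurd rfl h | 9, h => exact absurd rfl h | 11, h => exact absurd rfl h
    | _ + 13, h => exact absurd rfl h
  by_contra h
  have := key _ h
  omega

/-- `Aut₀(K)` has `2^8 = 256` elements. [cite: MongardiWandel2017, Thm. 4.2] -/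
theorem card_autZero : Nat.card (autZero K.variety) = 256 := by
  obtain ⟨e⟩ := K.nonempty_autZero_mulEquiv
  rw [Nat.card_congr (e.toEquiv.trans Multiplicative.toAdd), Nat.card_pi]
  simp

/-- **The reference is of OG6 type relative to itself** (non-vacuity of `IsOfOGradySixType K`:
the constant family over a point). [cite: Kodaira2005, §2.3 (trivial family)] -/
theorem isOfOGradySixType_self : IsOfOGradySixType K K.variety := by
  obtain ⟨A⟩ := K.nonempty_hodgeModel
  haveI := K.isProper
  exact areDeformationEquivalent_self A

end OGradySixReference

namespace IsOfOGradySixType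

variable {K : OGradySixReference} {X : Motives.SchemeOver ℂ}

/-- A variety of OG6 type (relative to `K`) is deformation equivalent to `K`. [cite: PeregoRapagnetta2013, Thm. 1.6] -/
theorem areDeformationEquivalent (h : IsOfOGradySixType K X) :
    AreDeformationEquivalent 6 K.variety X :=
  h

/-- … and conversely `K` is deformation equivalent to it. [folklore] -/
theorem areDeformationEquivalent_symm (h : IsOfOGradySixType K X) :
    AreDeformationEquivalent 6 X K.variety :=
  AreDeformationEquivalent.symm h

/-- A variety of OG6 type has an analytification by a compact complex manifold (it is a member of
a deformation; only compact manifolds are). [cite: Kodaira2005, §2.3 Def. 2.8 (i)] -/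
theorem exists_isAnalytification (h : IsOfOGradySixType K X) :
    ∃ (N : ComplexManifold.{0}) (ψ : N → Motives.ComplexPoints X), IsAnalytification N.model X 6 ψ := by
  obtain ⟨-, N, -, ψ, -, hψ, -⟩ := h
  exact ⟨N, ψ, hψ⟩

end IsOfOGradySixType

end Literature.AlgebraicGeometry.Hyperkaehler

end
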